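import Literature.NumberTheory.LFunctions.DirichletLSmoothedAFESeries
import HarnessLib

/-!
# The log-free convexity bound for primitive Dirichlet `L`-functions on the critical line:
# `|L(½ + it, χ)| ≤ C q^{1/4} (1 + |t|)`

Topic `Literature/NumberTheory/LFunctions`. Everything here is PROVED (no definitions, no named facts).

From the smooth approximate functional equation (`DirichletLSmoothedAFEIdentity`,
`DirichletLSmoothedAFESeries`: `2π Λ̃(χ,s) = I(χ,s) + ε(χ) I(χ̄,1−s)`,
`I(ψ,z) = 2π q^{z/2} γ_ψ(z) Σ_n ψ(n) V(w, n√(π/q)) n^{-z}`) and the trivial estimation of both sums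
(`DirichletLAFEKernelBounds`: `Σ_n n^{-1/2}|V| ≤ (2 + 10K) (q‖w‖/π)^{1/4}`), for every primitive
`χ` modulo `q > 1` and every real `t`:

* `norm_LFunction_half_le_sum` — `|L(½+it,χ)| ≤ |A(χ,s)| + |A(χ̄,1−s)|`
  (`|ε(χ)| = 1`, `|q^{(1−s)/2}| = |q^{s/2}|`, `|γ(1−s)| = |γ(s̄)| = |γ(s)|`);
* `dirichletL_logFreeConvexity` — **`∃ C, ∀ q > 1, ∀ χ primitive mod q, ∀ t,
  ‖L(½ + it, χ)‖ ≤ C q^{1/4} (1 + |t|)`** — the convexity bound WITHOUT logarithm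
  ([IwaniecKowalski2004, (5.20) for degree one]; no `log q` because `|χ(n)| ≤ 1` and the sums have
  length `≍ √(q(1+|t|))`). This is stub T3 of SKELETON I6c-typed (line `majorant-critical-line`,
  cell landau-siegel/ls-inputs) VERBATIM.

## References
* [IwaniecKowalski2004] H. Iwaniec, E. Kowalski, *Analytic Number Theory*, AMS Coll. Publ. 53
  (2004), §5.2, Theorem 5.3, Proposition 5.4, (5.20).
-/

noncomputable section

open Complex MeasureTheory Real Set Filter DirichletCharacter
open scoped Topology ComplexConjugate

namespace Literature.NumberTheory.LFunctions.DirichletConvexity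

open Literature.NumberTheory.LFunctions.SelbergDirichlet (gammaFactor_inv gammaFactor_ne_zero_of_re_pos
  isPrimitive_inv ne_one_of_isPrimitive gammaFactor_shape norm_rootNumber gammaFactor_conj)

variable {q : ℕ} [NeZero q]

/-! ### §1. One sum of the approximate functional equation -/

/-- **One sum is `≪ q^{1/4}(1+|t|)`**: there is an absolute `C₀` such that for every `q ≥ 1`,
every `a : ℕ → ℂ` with `|a(n)| ≤ 1`, every `w` with `1/4 ≤ Re w ≤ 3/4` and every `s` with
`Re s = ½`, the series `A = Σ_n a(n) V(w, n√(π/q)) n^{-s}` converges absolutely with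
`Σ_n |a(n) V(w, n√(π/q)) n^{-s}| ≤ C₀ q^{1/4} ‖w‖^{1/4}`.
[cite: IwaniecKowalski2004, (5.20)] -/
theorem exists_afe_sum_bound :
    ∃ C₀ : ℝ, 0 < C₀ ∧ ∀ (q : ℕ), 1 ≤ q → ∀ (a : ℕ → ℂ), (∀ n, ‖a n‖ ≤ 1) →
      ∀ w : ℂ, 1 / 4 ≤ w.re → w.re ≤ 3 / 4 → ∀ s : ℂ, s.re = 1 / 2 →
        Summable (fun n => ‖LSeries.term (fun n : ℕ => a n * ((1 / (2 * π) : ℂ) * ∫ v : ℝ,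
          (fun u : ℂ => Complex.Gamma (w + u / 2) / Complex.Gamma w)
            (((3 / 4 : ℝ) : ℂ) + v * I) * cexp ((((3 / 4 : ℝ) : ℂ) + v * I) ^ 2) *
            ((((n : ℝ) * Real.sqrt (π / q) : ℝ) : ℂ)) ^ (-(((3 / 4 : ℝ) : ℂ) + v * I)) /
            (((3 / 4 : ℝ) : ℂ) + v * I))) s n‖) ∧
        ∑' n, ‖LSeries.term (fun n : ℕ => a n * ((1 / (2 * π) : ℂ) * ∫ v : ℝ,
          (fun u : ℂ => Complex.Gamma (w + u / 2) / Complex.Gamma w)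
            (((3 / 4 : ℝ) : ℂ) + v * I) * cexp ((((3 / 4 : ℝ) : ℂ) + v * I) ^ 2) *
            ((((n : ℝ) * Real.sqrt (π / q) : ℝ) : ℂ)) ^ (-(((3 / 4 : ℝ) : ℂ) + v * I)) /
            (((3 / 4 : ℝ) : ℂ) + v * I))) s n‖ ≤ C₀ * (q : ℝ) ^ (1 / 4 : ℝ) * ‖w‖ ^ (1 / 4 : ℝ) := by
  obtain ⟨K, hK, hV⟩ := exists_V_bounds
  refine ⟨2 + 10 * K, by positivity, fun q hq a ha w hw1 hw2 s hs => ?_⟩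
  have hqR : (0 : ℝ) < q := by exact_mod_cast hq
  have hρ : 0 < Real.sqrt (π / q) := Real.sqrt_pos.2 (div_pos Real.pi_pos hqR)
  have hwre : 0 < w.re := by linarith
  have hW : 0 < ‖w‖ := norm_pos_iff.2 fun h => by rw [h] at hwre; simp at hwre
  have hy : ∀ n : ℕ, 1 ≤ n → 0 < (n : ℝ) * Real.sqrt (π / q) := fun n hn =>
    mul_pos (by exact_mod_cast hn) hρ
  have h := tsum_norm_term_le_of_bounds (K := K) (W := ‖w‖) (ρ := Real.sqrt (π / q)) hK.le hW hρ
    ha (V := fun n : ℕ => (1 / (2 * π) : ℂ) * ∫ v : ℝ,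
          (fun u : ℂ => Complex.Gamma (w + u / 2) / Complex.Gamma w)
            (((3 / 4 : ℝ) : ℂ) + v * I) * cexp ((((3 / 4 : ℝ) : ℂ) + v * I) ^ 2) *
            ((((n : ℝ) * Real.sqrt (π / q) : ℝ) : ℂ)) ^ (-(((3 / 4 : ℝ) : ℂ) + v * I)) /
            (((3 / 4 : ℝ) : ℂ) + v * I))
    (fun n hn => (hV w hw1 hw2 _ (hy n hn)).1) (fun n hn => (hV w hw1 hw2 _ (hy n hn)).2) hs
  refine ⟨h.1, h.2.trans ?_⟩
  -- `ρ^{-1/2} = (π/q)^{-1/4} ≤ q^{1/4}`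
  have hρ' : Real.sqrt (π / q) ^ (-(1 / 2) : ℝ) ≤ (q : ℝ) ^ (1 / 4 : ℝ) := by
    rw [Real.sqrt_eq_rpow, ← Real.rpow_mul (div_pos Real.pi_pos hqR).le,
      show ((1 / 2 : ℝ) * -(1 / 2)) = -(1 / 4) by norm_num, Real.rpow_neg (div_pos Real.pi_pos hqR).le,
      ← Real.inv_rpow (div_pos Real.pi_pos hqR).le, inv_div]
    exact Real.rpow_le_rpow (by positivity) (div_le_self hqR.le (by have := Real.pi_gt_three; linarith))
      (by norm_num)
  have hK0 : 0 ≤ 2 + 10 * K := by positivity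
  calc (2 + 10 * K) * (‖w‖ ^ (1 / 4 : ℝ) * Real.sqrt (π / q) ^ (-(1 / 2) : ℝ))
      ≤ (2 + 10 * K) * (‖w‖ ^ (1 / 4 : ℝ) * (q : ℝ) ^ (1 / 4 : ℝ)) := by gcongr
    _ = (2 + 10 * K) * (q : ℝ) ^ (1 / 4 : ℝ) * ‖w‖ ^ (1 / 4 : ℝ) := by ring

/-! ### §2. The convexity bound -/

omit [NeZero q] in
/-- `‖(s+κ)/2‖^{1/4} ≤ 1 + |t|` for `Re s = ½`, `Im s = ±t`, `κ ∈ {0,1}`. [folklore] -/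
private theorem norm_half_arg_rpow_le {s : ℂ} (hs : s.re = 1 / 2) {κ : ℕ} (hκ : κ ≤ 1) :
    ‖(s + κ) / 2‖ ^ (1 / 4 : ℝ) ≤ 1 + |s.im| := by
  have hκR : (κ : ℝ) ≤ 1 := by exact_mod_cast hκ
  have h1 : ‖(s + κ) / 2‖ ≤ 1 + |s.im| := by
    rw [norm_div, show ‖(2 : ℂ)‖ = 2 by norm_num]
    have h := Complex.norm_le_abs_re_add_abs_im (s + κ)
    have hre : |(s + (κ : ℂ)).re| ≤ 3 / 2 := by
      rw [add_re, natCast_re, hs]; rw [abs_of_nonneg (by positivity)]; linarith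
    have him : |(s + (κ : ℂ)).im| = |s.im| := by rw [add_im, natCast_im, add_zero]
    rw [him] at h
    have := abs_nonneg s.im
    linarith
  have h2 : 1 ≤ 1 + |s.im| := by have := abs_nonneg s.im; linarith
  calc ‖(s + κ) / 2‖ ^ (1 / 4 : ℝ) ≤ (1 + |s.im|) ^ (1 / 4 : ℝ) :=
        Real.rpow_le_rpow (norm_nonneg _) h1 (by norm_num)
    _ ≤ (1 + |s.im|) ^ (1 : ℝ) := Real.rpow_le_rpow_of_exponent_le h2 (by norm_num)
    _ = 1 + |s.im| := Real.rpow_one _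

/-- **THE LOG-FREE CONVEXITY BOUND** (stub T3 of SKELETON I6c-typed, VERBATIM). There is an
absolute constant `C` such that for every primitive Dirichlet character `χ` modulo `q > 1` and
every real `t`, `|L(½ + it, χ)| ≤ C q^{1/4} (1 + |t|)`. Proof: the smooth approximate functional
equation with `G(u) = e^{u²}` (`afe_contour_identity`, `afe_series_expansion`) gives
`L(s,χ) = A(χ,s) + ε(χ) (q^{(1−s)/2}γ(1−s))/(q^{s/2}γ(s)) · A(χ̄,1−s)` with `|ε| = 1`,
`|q^{(1−s)/2}| = |q^{s/2}|`, `|γ(1−s)| = |γ(s̄)| = |γ(s)|` on `Re s = ½`; and each sum is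
`≤ C₀ q^{1/4}(1+|t|)` (`exists_afe_sum_bound`). No logarithm of `q` appears because `|χ(n)| ≤ 1`
and both sums have length `≍ √(q(1+|t|))`.
[cite: IwaniecKowalski2004, Theorem 5.3, (5.20)] -/
theorem dirichletL_logFreeConvexity :
    ∃ C : ℝ, 0 < C ∧ ∀ (q : ℕ) [NeZero q], 1 < q → ∀ χ : DirichletCharacter ℂ q,
      χ.IsPrimitive → ∀ t : ℝ,
        ‖χ.LFunction (1 / 2 + t * I)‖ ≤ C * (q : ℝ) ^ (1 / 4 : ℝ) * (1 + |t|) := by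
  obtain ⟨C₀, hC₀, hA⟩ := exists_afe_sum_bound
  refine ⟨2 * C₀, by positivity, fun q _ hq χ hχ t => ?_⟩
  have hq1 : q ≠ 1 := by omega
  have hqpos : 0 < q := by omega
  have hq1' : 1 ≤ q := hqpos
  have hqR : (0 : ℝ) < q := by exact_mod_cast hqpos
  have hq0 : (q : ℂ) ≠ 0 := by exact_mod_cast hqpos.ne'
  have hχ1 : χ ≠ 1 := ne_one_of_isPrimitive hq1 hχ
  obtain ⟨κ, hκ, hγ⟩ := gammaFactor_shape χ
  have hγ' : ∀ w, gammaFactor χ⁻¹ w = Gammaℝ (w + κ) := fun w => by rw [gammaFactor_inv, hγ w]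
  set s : ℂ := 1 / 2 + t * I with hsdef
  have hs : s.re = 1 / 2 := by simp [hsdef]
  have hsim : s.im = t := by simp [hsdef]
  have hs' : (1 - s).re = 1 / 2 := by simp [hsdef]; norm_num
  have hs'im : (1 - s).im = -t := by simp [hsdef]
  have hconj : 1 - s = conj s := by
    apply Complex.ext <;> simp [hsdef]; norm_num
  -- the identity `2π Λ̃ = I₁ + ε I₂`, the two expansions and `Λ̃ = q^{s/2} γ L`
  have hid := afe_contour_identity hq hχ hs
  have hI1 := afe_series_expansion hq χ hκ hγ hs
  have hI2 := afe_series_expansion hq χ⁻¹ hκ hγ' hs'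
  rw [hI1, hI2] at hid
  have hΛ : completedLFunction χ s = gammaFactor χ s * LFunction χ s := by
    rw [LFunction_eq_completed_div_gammaFactor χ s (Or.inr hq1)]
    field_simp [gammaFactor_ne_zero_of_re_pos χ (show 0 < s.re by rw [hs]; norm_num)]
  rw [hΛ] at hid
  -- names for the two sums
  set A₁ : ℂ := LSeries (fun n : ℕ => χ n * ((1 / (2 * π) : ℂ) * ∫ v : ℝ,
      (fun u : ℂ => Complex.Gamma ((s + κ) / 2 + u / 2) / Complex.Gamma ((s + κ) / 2))
        (((3 / 4 : ℝ) : ℂ) + v * I) * cexp ((((3 / 4 : ℝ) : ℂ) + v * I) ^ 2) *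
        ((((n : ℝ) * Real.sqrt (π / q) : ℝ) : ℂ)) ^ (-(((3 / 4 : ℝ) : ℂ) + v * I)) /
        (((3 / 4 : ℝ) : ℂ) + v * I))) s with hA₁
  set A₂ : ℂ := LSeries (fun n : ℕ => χ⁻¹ n * ((1 / (2 * π) : ℂ) * ∫ v : ℝ,
      (fun u : ℂ => Complex.Gamma ((1 - s + κ) / 2 + u / 2) / Complex.Gamma ((1 - s + κ) / 2))
        (((3 / 4 : ℝ) : ℂ) + v * I) * cexp ((((3 / 4 : ℝ) : ℂ) + v * I) ^ 2) *
        ((((n : ℝ) * Real.sqrt (π / q) : ℝ) : ℂ)) ^ (-(((3 / 4 : ℝ) : ℂ) + v * I)) /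
        (((3 / 4 : ℝ) : ℂ) + v * I))) (1 - s) with hA₂
  -- norms of the scalar factors
  have hγ0 : gammaFactor χ s ≠ 0 := gammaFactor_ne_zero_of_re_pos χ (by rw [hs]; norm_num)
  have hnq : ‖(q : ℂ) ^ ((1 - s) / 2)‖ = ‖(q : ℂ) ^ (s / 2)‖ := by
    rw [Complex.norm_natCast_cpow_of_pos hqpos, Complex.norm_natCast_cpow_of_pos hqpos]
    congr 1; simp [hsdef]; norm_num
  have hnγ : ‖gammaFactor χ⁻¹ (1 - s)‖ = ‖gammaFactor χ s‖ := by
    rw [gammaFactor_inv, hconj, gammaFactor_conj, norm_conj]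
  have hε : ‖rootNumber χ‖ = 1 := norm_rootNumber hχ
  -- `‖L − A₁‖ = ‖A₂‖`
  have hπ0 : (0 : ℝ) < 2 * π := by positivity
  have hkey : 2 * π * ((q : ℂ) ^ (s / 2) * gammaFactor χ s) * (LFunction χ s - A₁) =
      rootNumber χ * (2 * π * ((q : ℂ) ^ ((1 - s) / 2) * gammaFactor χ⁻¹ (1 - s) * A₂)) := by
    linear_combination hid
  have hnorm : ‖LFunction χ s - A₁‖ = ‖A₂‖ := by
    have h := congrArg norm hkey
    simp only [norm_mul, hε, one_mul, hnq, hnγ] at h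
    have hpos : 0 < ‖(2 : ℂ)‖ * ‖(π : ℂ)‖ * (‖(q : ℂ) ^ (s / 2)‖ * ‖gammaFactor χ s‖) := by
      have h1 : 0 < ‖(q : ℂ) ^ (s / 2)‖ := norm_pos_iff.2 (by
        rw [Ne, Complex.cpow_eq_zero_iff]; exact fun h => hq0 h.1)
      have h2 : 0 < ‖gammaFactor χ s‖ := norm_pos_iff.2 hγ0
      have h3 : 0 < ‖(π : ℂ)‖ := norm_pos_iff.2 (ofReal_ne_zero.2 Real.pi_pos.ne')
      have h4 : 0 < ‖(2 : ℂ)‖ := by norm_num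
      positivity
    exact mul_left_cancel₀ hpos.ne' (by linarith [h])
  -- the two sums
  have hκ0 : (0 : ℝ) ≤ κ := Nat.cast_nonneg κ
  have hκ1 : (κ : ℝ) ≤ 1 := by exact_mod_cast hκ
  have hw1re : ((s + (κ : ℂ)) / 2).re = (1 / 2 + (κ : ℝ)) / 2 := by
    rw [Complex.div_ofNat_re, add_re, hs, natCast_re]
  have hw2re : ((1 - s + (κ : ℂ)) / 2).re = (1 / 2 + (κ : ℝ)) / 2 := by
    rw [Complex.div_ofNat_re, add_re, hs', natCast_re]
  have hb1 := hA q hq1' (fun n : ℕ => χ n) (fun n => χ.norm_le_one _) ((s + κ) / 2)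
    (by rw [hw1re]; linarith) (by rw [hw1re]; linarith) s hs
  have hb2 := hA q hq1' (fun n : ℕ => χ⁻¹ n) (fun n => χ⁻¹.norm_le_one _) ((1 - s + κ) / 2)
    (by rw [hw2re]; linarith) (by rw [hw2re]; linarith) (1 - s) hs'
  have hA₁le : ‖A₁‖ ≤ C₀ * (q : ℝ) ^ (1 / 4 : ℝ) * (1 + |t|) := by
    rw [hA₁, LSeries]
    refine (norm_tsum_le_tsum_norm hb1.1).trans (hb1.2.trans ?_)
    have := norm_half_arg_rpow_le hs hκ
    rw [hsim] at this
    gcongr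
  have hA₂le : ‖A₂‖ ≤ C₀ * (q : ℝ) ^ (1 / 4 : ℝ) * (1 + |t|) := by
    rw [hA₂, LSeries]
    refine (norm_tsum_le_tsum_norm hb2.1).trans (hb2.2.trans ?_)
    have := norm_half_arg_rpow_le hs' hκ
    rw [hs'im, abs_neg] at this
    gcongr
  calc ‖LFunction χ s‖ = ‖A₁ + (LFunction χ s - A₁)‖ := by ring_nf
    _ ≤ ‖A₁‖ + ‖LFunction χ s - A₁‖ := norm_add_le _ _
    _ = ‖A₁‖ + ‖A₂‖ := by rw [hnorm]
    _ ≤ C₀ * (q : ℝ) ^ (1 / 4 : ℝ) * (1 + |t|) + C₀ * (q : ℝ) ^ (1 / 4 : ℝ) * (1 + |t|) :=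
        add_le_add hA₁le hA₂le
    _ = 2 * C₀ * (q : ℝ) ^ (1 / 4 : ℝ) * (1 + |t|) := by ring

end Literature.NumberTheory.LFunctions.DirichletConvexity

end
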